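import Mathlib.RingTheory.RootsOfUnity.AlgebraicallyClosed
import Literature.NumberTheory.GaloisRepresentations.SuperellipticPicDivisible
import Literature.NumberTheory.GaloisRepresentations.AbsIntegersLocalization
import Literature.NumberTheory.GaloisRepresentations.SuperellipticPointPlaces
import HarnessLib

/-!
# Reduction of the superelliptic curve `y^p = f(x)` modulo a prime of `ℤ̄`: places and divisors

Deuring's reduction of the function field `K̄(C_f)` of `C_f : y^p = f(x)` (`f = f₀ ⊗ K`, `f₀ ∈ 𝓞_K[X]`) along a
maximal ideal `𝔓` of `ℤ̄ = absIntegers (𝓞 K) K` above `𝔭 ⊂ 𝓞_K`, made completely explicit for this plane curve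
with one point at infinity (`p ∤ deg f`):

* the integral model `fLoc f₀ 𝔓 ∈ ℤ̄_𝔓[X]` over the valuation ring `ℤ̄_𝔓 = absIntegersLocalization 𝔓` and its two
  fibres `f_K ⊗ K̄` (`fLoc_map_subtype`) and `f̄ = (f₀ mod 𝔭) ⊗ (ℤ̄/𝔓)` (`fLoc_map_residue`);
* integral points: `b^p = f(a)`, `a ∈ ℤ̄_𝔓 ⟹ b ∈ ℤ̄_𝔓` (`mem_of_pow_eq_eval`); roots of `f` are integral when
  `deg f̄ = deg f` (`mem_of_isRoot`); above an unramified point of the special fibre, integral points with the same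
  reduction have distinct `x`-coordinates (`eq_of_residue_eq`);
* the **reduction of places** `redPlace 𝔭 𝔓 : places of K̄(C_f) → places of κ(C_f̄)`, `κ = ℤ̄/𝔓`: the place of an
  integral point `(a, b)` goes to the place of `(ā, b̄)` (`redPlace_pointPlace`), the place `∞` and the places of
  non-integral points go to `∞̄` (`redPlace_inftyPlace`, `redPlace_pointPlace_of_not_mem`);
* the **reduction of divisors** `redDiv 𝔭 𝔓 = mapDomain redPlace : Div(K̄(C_f)) →+ Div(κ(C_f̄))`, degree
  preserving (`degree_redDiv`).

That `redDiv` maps principal divisors to principal divisors, and the induced map on divisor classes, are in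
`SuperellipticReductionLocal`, `SuperellipticReductionPrincipal`, `SuperellipticReductionPic`.

## References
* [cite: Deuring1942Reduktion, §§2–3]
-/

noncomputable section

open Polynomial
open scoped NumberField Classical Polynomial.Bivariate

namespace Literature.NumberTheory.GaloisRepresentations

open Field IsDedekindDomain Literature.NumberTheory.DiophantineGeometry
  Literature.NumberTheory.DiophantineGeometry.AlgFunctionField SuperellipticFunctionField

attribute [local instance] Ideal.Quotient.field

set_option synthInstance.maxHeartbeats 160000

namespace SuperellipticReduction

variable {K : Type} [Field K] [NumberField K] {p : ℕ} [hp : Fact p.Prime] {f₀ : (𝓞 K)[X]}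
variable {𝔭 : HeightOneSpectrum (𝓞 K)} {𝔓 : Ideal (absIntegers (𝓞 K) K)} [h𝔓m : 𝔓.IsMaximal] [h𝔓 : 𝔓.LiesOver 𝔭.asIdeal]

set_option hygiene false in
/-- `K̄`, the algebraic closure carrying the generic fibre. -/
local notation "K̄" => AlgebraicClosure K
set_option hygiene false in
/-- `𝒪 = ℤ̄_𝔓`. -/
local notation "𝒪" => absIntegersLocalization 𝔓
set_option hygiene false in
/-- `κ = ℤ̄/𝔓`, the constant field of the special fibre. -/
local notation "κ" => (absIntegers (𝓞 K) K ⧸ 𝔓)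
set_option hygiene false in
/-- `k = 𝓞 K / 𝔭`. -/
local notation "k𝔭" => (𝓞 K ⧸ 𝔭.asIdeal)
set_option hygiene false in
/-- `f_K ∈ K[X]`, the generic fibre polynomial. -/
local notation "fK" => (Polynomial.map (algebraMap (𝓞 K) K) f₀)
set_option hygiene false in
/-- `f̄ ∈ k[X]`, the special fibre polynomial. -/
local notation "fk" => (Polynomial.map (Ideal.Quotient.mk 𝔭.asIdeal) f₀)
set_option hygiene false in
/-- `K̄(C_f)`. -/
local notation "FK" => SuperellipticFunctionField K (AlgebraicClosure K) p (Polynomial.map (algebraMap (𝓞 K) K) f₀)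
set_option hygiene false in
/-- `κ(C_f̄)`. -/
local notation "Fκ" =>
  SuperellipticFunctionField (𝓞 K ⧸ 𝔭.asIdeal) (absIntegers (𝓞 K) K ⧸ 𝔓) p (Polynomial.map (Ideal.Quotient.mk 𝔭.asIdeal) f₀)

/-! ### The integral model over `ℤ̄_𝔓` and its two fibres -/

variable (𝔓) in
/-- `𝓞 K → ℤ̄_𝔓`. [folklore] -/
def intToLoc : 𝓞 K →+* absIntegersLocalization 𝔓 :=
  (algebraMap (𝓞 K) (AlgebraicClosure K)).codRestrict (absIntegersLocalization 𝔓) fun r =>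
    coe_mem_absIntegersLocalization 𝔓 (algebraMap (𝓞 K) (absIntegers (𝓞 K) K) r)

omit [NumberField K] in
/-- `intToLoc r = r` in `K̄`. [folklore] -/
@[simp]
theorem coe_intToLoc (r : 𝓞 K) : ((intToLoc 𝔓 r : 𝒪) : K̄) = algebraMap (𝓞 K) K̄ r := rfl

omit [NumberField K] in
/-- `intToLoc r` reduces to `r mod 𝔭` (through `k → κ`). [folklore] -/
theorem residue_intToLoc (r : 𝓞 K) :
    absIntegersResidue 𝔓 (intToLoc 𝔓 r) = algebraMap k𝔭 κ (Ideal.Quotient.mk 𝔭.asIdeal r) := by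
  have h : intToLoc 𝔓 r = ⟨((algebraMap (𝓞 K) (absIntegers (𝓞 K) K) r : absIntegers (𝓞 K) K) : K̄),
      coe_mem_absIntegersLocalization 𝔓 _⟩ := rfl
  rw [Ideal.Quotient.algebraMap_mk_of_liesOver, h, absIntegersResidue_coe]

variable (𝔓 f₀) in
/-- **The integral model `f_𝒪 ∈ ℤ̄_𝔓[X]`** of `f`. [folklore] -/
def fLoc : (absIntegersLocalization 𝔓)[X] := f₀.map (intToLoc 𝔓)

omit [NumberField K] in
/-- The integral model maps to `f_K` over `K̄`. [folklore] -/
theorem fLoc_map_subtype : (fLoc f₀ 𝔓).map (absIntegersLocalization 𝔓).subtype = (fK).map (algebraMap K K̄) := by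
  rw [fLoc, Polynomial.map_map, Polynomial.map_map]
  exact congrArg (fun φ : 𝓞 K →+* K̄ => f₀.map φ)
    (RingHom.ext fun r => (IsScalarTower.algebraMap_apply (𝓞 K) K K̄ r :))

omit [NumberField K] in
/-- The integral model reduces to `f̄` over `κ`. [folklore] -/
theorem fLoc_map_residue :
    (fLoc f₀ 𝔓).map (absIntegersResidue 𝔓) = (fk).map (algebraMap k𝔭 κ) := by
  rw [fLoc, Polynomial.map_map, Polynomial.map_map]
  exact congrArg (fun φ : 𝓞 K →+* κ => f₀.map φ) (RingHom.ext fun r => residue_intToLoc (𝔭 := 𝔭) r)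

omit [NumberField K] in
/-- `f_𝒪(a) = f(a)` in `K̄` for `a ∈ ℤ̄_𝔓`. [folklore] -/
theorem coe_eval_fLoc (a : 𝒪) : ((((fLoc f₀ 𝔓).eval a : 𝒪) : K̄)) = ((fK).map (algebraMap K K̄)).eval (a : K̄) := by
  rw [← fLoc_map_subtype (𝔓 := 𝔓), eval_map]
  exact (eval₂_hom (absIntegersLocalization 𝔓).subtype a).symm

omit [NumberField K] in
/-- `f_𝒪(a)` reduces to `f̄(ā)`. [folklore] -/
theorem residue_eval_fLoc (a : 𝒪) :
    absIntegersResidue 𝔓 ((fLoc f₀ 𝔓).eval a) = ((fk).map (algebraMap k𝔭 κ)).eval (absIntegersResidue 𝔓 a) := by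
  rw [← fLoc_map_residue, eval_map, eval₂_hom]

/-! ### Roots of unity and the residue characteristic -/

omit [NumberField K] hp h𝔓m in
/-- `p ≠ 0` in `κ` when `𝔭 ∤ p`. [folklore] -/
theorem natCast_residue_ne_zero (hp𝔭 : (p : 𝓞 K) ∉ 𝔭.asIdeal) : (p : κ) ≠ 0 := by
  intro h
  have h1 : ((p : absIntegers (𝓞 K) K) : absIntegers (𝓞 K) K) ∈ 𝔓 := by
    rw [← Ideal.Quotient.eq_zero_iff_mem, map_natCast]; exact h
  apply hp𝔭
  have h2 : (p : 𝓞 K) ∈ 𝔓.comap (algebraMap (𝓞 K) (absIntegers (𝓞 K) K)) := by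
    rw [Ideal.mem_comap, map_natCast]; exact h1
  rwa [← Ideal.under_def, ← Ideal.LiesOver.over (p := 𝔭.asIdeal) (P := 𝔓)] at h2

/-- A primitive `p`-th root of unity in `K̄` (characteristic `0`). [folklore] -/
theorem exists_isPrimitiveRoot_algClosure : ∃ ζ₀ : K̄, IsPrimitiveRoot ζ₀ p := by
  haveI : NeZero ((p : ℕ) : K̄) := ⟨Nat.cast_ne_zero.2 hp.out.ne_zero⟩
  exact HasEnoughRootsOfUnity.exists_primitiveRoot K̄ p

omit [NumberField K] hp in
/-- A primitive `p`-th root of unity in `κ` (`𝔭 ∤ p`, `κ` algebraically closed). [folklore] -/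
theorem exists_isPrimitiveRoot_residue (hp𝔭 : (p : 𝓞 K) ∉ 𝔭.asIdeal) :
    ∃ ζ₀ : κ, IsPrimitiveRoot ζ₀ p := by
  haveI : NeZero ((p : ℕ) : κ) := ⟨natCast_residue_ne_zero hp𝔭⟩
  haveI : IsAlgClosed κ := absIntegers.isAlgClosed_quotient 𝔓
  exact HasEnoughRootsOfUnity.exists_primitiveRoot κ p

omit [NumberField K] hp in
/-- **A `p`-th root of unity `≡ 1 (mod 𝔓)` is `1`** (`𝔭 ∤ p`): otherwise `1 + η + ⋯ + η^{p-1} = 0`, which reduces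
to `p = 0` in `κ`. [folklore] -/
theorem eq_one_of_pow_eq_one_of_residue_eq_one (hp𝔭 : (p : 𝓞 K) ∉ 𝔭.asIdeal) {η : 𝒪} (hη : η ^ p = 1)
    (hres : absIntegersResidue 𝔓 η = 1) : η = 1 := by
  by_contra hne
  have hsum : (∑ i ∈ Finset.range p, η ^ i) * (η - 1) = 0 := by rw [geom_sum_mul, hη, sub_self]
  have hsum0 : ∑ i ∈ Finset.range p, η ^ i = 0 :=
    (mul_eq_zero.1 hsum).resolve_right (sub_ne_zero.2 hne)
  have h := congrArg (absIntegersResidue 𝔓) hsum0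
  rw [map_sum, map_zero] at h
  simp only [map_pow, hres, one_pow, Finset.sum_const, Finset.card_range, nsmul_eq_mul, mul_one] at h
  exact natCast_residue_ne_zero hp𝔭 h

/-! ### Integral points -/

/-- **`y`-coordinates of integral points are integral**: if `a ∈ ℤ̄_𝔓` and `b^p = f(a)` then `b ∈ ℤ̄_𝔓`
(`ℤ̄_𝔓` is a valuation ring: else `b⁻¹ ∈ 𝔪` and `1 = b^{-p} f(a)` reduces to `0`). [folklore] -/
theorem mem_of_pow_eq_eval {a : 𝒪} {b : K̄} (hb : b ^ p = ((fK).map (algebraMap K K̄)).eval (a : K̄)) : b ∈ 𝒪 := by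
  by_contra hbO
  obtain ⟨hb0, hinv, hres⟩ := inv_mem_and_residue_eq_zero_of_not_mem 𝔓 hbO
  have h1 : (⟨b⁻¹, hinv⟩ : 𝒪) ^ p * (fLoc f₀ 𝔓).eval a = 1 := Subtype.ext (by
    rw [Subring.coe_mul, Subring.coe_pow, coe_eval_fLoc, ← hb, Subring.coe_one]
    change (b⁻¹) ^ p * b ^ p = 1
    rw [inv_pow, inv_mul_cancel₀ (pow_ne_zero _ hb0)])
  have h2 := congrArg (absIntegersResidue 𝔓) h1
  rw [map_mul, map_pow, hres, zero_pow hp.out.ne_zero, zero_mul, map_one] at h2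
  exact zero_ne_one h2

/-- **Roots of `f` are `𝔓`-integral** when `deg (f mod 𝔭) = deg f` (the leading coefficient is a `𝔭`-unit):
else `α⁻¹ ∈ 𝔪` and `lead f = -∑_{i<d} c_i α^{i-d} ∈ 𝔪`. [folklore] -/
theorem mem_of_isRoot (hsep𝔭 : (fk).Separable) (hdeg : (fk).natDegree = f₀.natDegree) {α : K̄}
    (hα : ((fK).map (algebraMap K K̄)).IsRoot α) :
    α ∈ 𝒪 := by
  by_contra hαO
  obtain ⟨hα0, hinv, hres⟩ := inv_mem_and_residue_eq_zero_of_not_mem 𝔓 hαO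
  set d := f₀.natDegree with hd
  set g := fLoc f₀ 𝔓 with hg
  have hgd : g.natDegree ≤ d := by rw [hg, fLoc]; exact natDegree_map_le
  -- `0 = α^{-d} f(α) = ∑ c_i (α⁻¹)^{d-i}`
  have hsum : ∑ i ∈ Finset.range (d + 1), g.coeff i * (⟨α⁻¹, hinv⟩ : 𝒪) ^ (d - i) = 0 := by
    apply Subtype.ext
    rw [AddSubmonoidClass.coe_finsetSum, Subring.coe_zero]
    have hroot : ((fK).map (algebraMap K K̄)).eval α = 0 := hα
    rw [← fLoc_map_subtype (𝔓 := 𝔓), ← hg, eval_map, eval₂_eq_sum_range' (absIntegersLocalization 𝔓).subtype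
      (show g.natDegree < d + 1 by omega)] at hroot
    have h2 := congrArg (fun z => z * (α⁻¹) ^ d) hroot
    simp only [zero_mul, Finset.sum_mul] at h2
    rw [← h2]
    refine Finset.sum_congr rfl fun i hi => ?_
    have hi' : i ≤ d := Nat.lt_succ_iff.1 (Finset.mem_range.1 hi)
    rw [Subring.coe_mul, Subring.coe_pow, Subring.coe_subtype, mul_assoc]
    congr 1
    change (α⁻¹) ^ (d - i) = α ^ i * (α⁻¹) ^ d
    rw [inv_pow, inv_pow, eq_mul_inv_iff_mul_eq₀ (pow_ne_zero _ hα0), ← pow_sub_mul_pow α hi',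
      inv_mul_cancel_left₀ (pow_ne_zero _ hα0)]
  -- reduce: all terms with `i < d` vanish, the term `i = d` is `lead f mod 𝔓`
  have h := congrArg (absIntegersResidue 𝔓) hsum
  rw [map_sum, map_zero, Finset.sum_range_succ] at h
  have hvan : ∑ i ∈ Finset.range d, absIntegersResidue 𝔓 (g.coeff i * (⟨α⁻¹, hinv⟩ : 𝒪) ^ (d - i)) = 0 :=
    Finset.sum_eq_zero fun i hi => by
      have hi' : i < d := Finset.mem_range.1 hi
      rw [map_mul, map_pow, hres, zero_pow (by omega), mul_zero]
  rw [hvan, zero_add, Nat.sub_self, pow_zero, mul_one, ← coeff_map, hg, fLoc_map_residue (𝔭 := 𝔭), coeff_map,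
    coeff_map] at h
  change Ideal.Quotient.mk 𝔓 (algebraMap (𝓞 K) (absIntegers (𝓞 K) K) (f₀.coeff d)) = 0 at h
  rw [Ideal.Quotient.eq_zero_iff_mem] at h
  have hlead : (fk).coeff d ≠ 0 := by
    rw [← hdeg, coeff_natDegree]
    exact leadingCoeff_ne_zero.2 hsep𝔭.ne_zero
  apply hlead
  rw [coeff_map, Ideal.Quotient.eq_zero_iff_mem]
  have h2 : f₀.coeff d ∈ 𝔓.comap (algebraMap (𝓞 K) (absIntegers (𝓞 K) K)) := Ideal.mem_comap.2 h
  rwa [← Ideal.under_def, ← Ideal.LiesOver.over (p := 𝔭.asIdeal) (P := 𝔓)] at h2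

omit [NumberField K] hp in
/-- **The reduction of an integral point is a point of the special fibre**: `b̄^p = f̄(ā)`. [folklore] -/
theorem residue_pow_eq_eval {a b : 𝒪} (hb : (b : K̄) ^ p = ((fK).map (algebraMap K K̄)).eval (a : K̄)) :
    absIntegersResidue 𝔓 b ^ p = ((fk).map (algebraMap k𝔭 κ)).eval (absIntegersResidue 𝔓 a) := by
  have h1 : b ^ p = (fLoc f₀ 𝔓).eval a := Subtype.ext (by rw [Subring.coe_pow, hb, coe_eval_fLoc])
  rw [← map_pow, h1, residue_eval_fLoc (𝔭 := 𝔭)]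

omit [NumberField K] in
/-- **Distinct integral points with the same reduction have distinct `x`-coordinates** above an unramified point
of the special fibre: if `(a, b), (a, b')` are points with `b̄ = b̄'` and `f̄(ā) ≠ 0` then `b = b'` (the `p`-th root
of unity `b'/b` reduces to `1`). [folklore] -/
theorem eq_of_residue_eq (hp𝔭 : (p : 𝓞 K) ∉ 𝔭.asIdeal) {a b b' : 𝒪}
    (hb : (b : K̄) ^ p = ((fK).map (algebraMap K K̄)).eval (a : K̄))
    (hb' : (b' : K̄) ^ p = ((fK).map (algebraMap K K̄)).eval (a : K̄))
    (hā : ((fk).map (algebraMap k𝔭 κ)).eval (absIntegersResidue 𝔓 a) ≠ 0)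
    (hres : absIntegersResidue 𝔓 b = absIntegersResidue 𝔓 b') : b = b' := by
  have hresb : absIntegersResidue 𝔓 b ≠ 0 := fun h0 => hā (by
    rw [← residue_pow_eq_eval hb, h0, zero_pow hp.out.ne_zero])
  have hb0 : (b : K̄) ≠ 0 := fun h0 => hresb (by rw [show b = 0 from Subtype.ext h0, map_zero])
  have hbinv : (b : K̄)⁻¹ ∈ 𝒪 := (inv_mem_absIntegersLocalization_iff 𝔓 b hb0).2 hresb
  set η : 𝒪 := b' * ⟨(b : K̄)⁻¹, hbinv⟩ with hη
  have hηp : η ^ p = 1 := Subtype.ext (by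
    rw [Subring.coe_pow, hη, Subring.coe_mul, Subring.coe_one]
    change ((b' : K̄) * (b : K̄)⁻¹) ^ p = 1
    rw [mul_pow, inv_pow, hb', ← hb, mul_inv_cancel₀ (pow_ne_zero _ hb0)])
  have hηres : absIntegersResidue 𝔓 η = 1 := by
    have h1 : absIntegersResidue 𝔓 (b * ⟨(b : K̄)⁻¹, hbinv⟩) = 1 := by
      rw [show b * (⟨(b : K̄)⁻¹, hbinv⟩ : 𝒪) = 1 from Subtype.ext (mul_inv_cancel₀ hb0), map_one]
    rw [map_mul] at h1
    rw [hη, map_mul, ← hres, h1]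
  have hη1 := eq_one_of_pow_eq_one_of_residue_eq_one hp𝔭 hηp hηres
  have : (b' : K̄) * (b : K̄)⁻¹ = 1 := by
    have := congrArg (fun z : 𝒪 => (z : K̄)) hη1
    simpa [hη] using this
  exact Subtype.ext ((mul_inv_eq_one₀ hb0).1 this).symm

variable [hirrK : Fact (Irreducible (superellipticPoly K (AlgebraicClosure K) p (fK)))]
  [hirrκ : Fact (Irreducible (superellipticPoly (𝓞 K ⧸ 𝔭.asIdeal) (absIntegers (𝓞 K) K ⧸ 𝔓) p (fk)))]

/-! ### The reduction of places -/

variable (𝔭 𝔓) in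
/-- **Reduction of places** `Q ↦ Q̄` from `K̄(C_f)` to `κ(C_f̄)`: the place of a `𝔓`-integral point `(a, b)` goes to the
place of its reduction `(ā, b̄)`; the place at infinity and the places of non-integral points go to the place at
infinity (Deuring's reduction of prime divisors along `𝔓`, for the smooth affine model `y^p = f(x)`).
[cite: Deuring1942Reduktion, §2] -/
def redPlace (Q : PlaceOver K̄ FK) : PlaceOver κ Fκ :=
  if h : ∃ a b : 𝒪, (b : K̄) ^ p = ((fK).map (algebraMap K K̄)).eval (a : K̄) ∧ Q = pointPlace K K̄ p (fK) (a : K̄) (b : K̄)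
  then pointPlace k𝔭 κ p (fk) (absIntegersResidue 𝔓 h.choose) (absIntegersResidue 𝔓 h.choose_spec.choose)
  else inftyPlace k𝔭 κ p (fk)

/-- **The reduction of the place of an integral point is the place of the reduced point.** [cite: Deuring1942Reduktion, §2] -/
theorem redPlace_pointPlace {ζ₀ : K̄} (hζ₀ : IsPrimitiveRoot ζ₀ p) (hsep : (fK).Separable) (a b : 𝒪)
    (hb : (b : K̄) ^ p = ((fK).map (algebraMap K K̄)).eval (a : K̄)) :
    redPlace 𝔭 𝔓 (pointPlace K K̄ p (fK) (a : K̄) (b : K̄)) =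
      pointPlace k𝔭 κ p (fk) (absIntegersResidue 𝔓 a) (absIntegersResidue 𝔓 b) := by
  have h : ∃ a' b' : 𝒪, (b' : K̄) ^ p = ((fK).map (algebraMap K K̄)).eval (a' : K̄) ∧
      pointPlace K K̄ p (fK) (a : K̄) (b : K̄) = pointPlace K K̄ p (fK) (a' : K̄) (b' : K̄) := ⟨a, b, hb, rfl⟩
  rw [redPlace, dif_pos h]
  obtain ⟨ha', hb'⟩ := pointPlace_inj hζ₀ hsep hb h.choose_spec.choose_spec.1 h.choose_spec.choose_spec.2
  exact (congrArg₂ (fun u v : 𝒪 => pointPlace k𝔭 κ p (fk) (absIntegersResidue 𝔓 u) (absIntegersResidue 𝔓 v))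
    (Subtype.ext ha') (Subtype.ext hb')).symm

/-- **`∞` reduces to `∞̄`.** [cite: Deuring1942Reduktion, §2] -/
theorem redPlace_inftyPlace {ζ₀ : K̄} (hζ₀ : IsPrimitiveRoot ζ₀ p) (hsep : (fK).Separable) :
    redPlace 𝔭 𝔓 (inftyPlace K K̄ p (fK)) = inftyPlace k𝔭 κ p (fk) := by
  rw [redPlace, dif_neg]
  rintro ⟨a, b, hb, h⟩
  exact pointPlace_ne_inftyPlace hζ₀ hsep hb h.symm

/-- **Non-integral points reduce to `∞̄`.** [cite: Deuring1942Reduktion, §2] -/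
theorem redPlace_pointPlace_of_not_mem {ζ₀ : K̄} (hζ₀ : IsPrimitiveRoot ζ₀ p) (hsep : (fK).Separable) {a b : K̄}
    (hb : b ^ p = ((fK).map (algebraMap K K̄)).eval a) (ha : a ∉ 𝒪) :
    redPlace 𝔭 𝔓 (pointPlace K K̄ p (fK) a b) = inftyPlace k𝔭 κ p (fk) := by
  rw [redPlace, dif_neg]
  rintro ⟨a', b', hb', h⟩
  obtain ⟨rfl, -⟩ := pointPlace_inj hζ₀ hsep hb hb' h
  exact ha a'.2

omit hp in
/-- A place whose reduction is not `∞̄` is the place of an integral point. [folklore] -/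
theorem exists_eq_pointPlace_of_redPlace_ne_inftyPlace {Q : PlaceOver K̄ FK}
    (hQ : redPlace 𝔭 𝔓 Q ≠ inftyPlace k𝔭 κ p (fk)) :
    ∃ a b : 𝒪, (b : K̄) ^ p = ((fK).map (algebraMap K K̄)).eval (a : K̄) ∧ Q = pointPlace K K̄ p (fK) (a : K̄) (b : K̄) := by
  by_contra h
  rw [redPlace, dif_neg h] at hQ
  exact hQ rfl

/-! ### The reduction of divisors -/

variable (𝔭 𝔓) in
/-- **Reduction of divisors** `D ↦ D̄ = ∑ n_Q · Q̄` (push-forward along the reduction of places). [cite: Deuring1942Reduktion, §2] -/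
def redDiv : Divisor K̄ FK →+ Divisor κ Fκ :=
  Finsupp.mapDomain.addMonoidHom (redPlace 𝔭 𝔓)

omit hp in
/-- `D̄ = mapDomain redPlace D`. [folklore] -/
theorem redDiv_apply_eq (D : Divisor K̄ FK) : redDiv 𝔭 𝔓 D = Finsupp.mapDomain (redPlace 𝔭 𝔓) D := rfl

omit hp in
/-- `(n · Q)‾ = n · Q̄`. [folklore] -/
@[simp]
theorem redDiv_single (Q : PlaceOver K̄ FK) (n : ℤ) : redDiv 𝔭 𝔓 (Finsupp.single Q n) = Finsupp.single (redPlace 𝔭 𝔓 Q) n := by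
  rw [redDiv_apply_eq, Finsupp.mapDomain_single]

omit hp in
/-- **The coefficient of `Q̄` in `D̄`** is the sum of the coefficients of `D` at the places reducing to `Q̄`. [folklore] -/
theorem redDiv_apply (D : Divisor K̄ FK) (Q' : PlaceOver κ Fκ) :
    redDiv 𝔭 𝔓 D Q' = ∑ Q ∈ D.support.filter (fun Q => redPlace 𝔭 𝔓 Q = Q'), D Q := by
  rw [redDiv_apply_eq, Finsupp.mapDomain, Finsupp.sum_apply, Finsupp.sum, Finset.sum_filter]
  exact Finset.sum_congr rfl fun Q _ => by rw [Finsupp.single_apply]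

omit hp in
/-- **Reduction preserves degrees** (all places on both fibres are rational). [cite: Deuring1942Reduktion, §2] -/
theorem degree_redDiv (D : Divisor K̄ FK) : (redDiv 𝔭 𝔓 D).degree = D.degree := by
  haveI : IsAlgClosed κ := absIntegers.isAlgClosed_quotient 𝔓
  induction D using Finsupp.induction with
  | zero => simp only [map_zero]
  | single_add Q n D _ _ ih =>
    have h1 : (redPlace 𝔭 𝔓 Q).degree = 1 := PlaceOver.isRational_of_isAlgClosed _
    have h2 : Q.degree = 1 := PlaceOver.isRational_of_isAlgClosed _
    rw [map_add, map_add, map_add, ih, redDiv_single, Divisor.degree_single, Divisor.degree_single, h1, h2]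

end SuperellipticReduction

end Literature.NumberTheory.GaloisRepresentations
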